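import Literature.MathematicalPhysics.QuantumLattice.StabilityTailCoreProofs
import Literature.MathematicalPhysics.QuantumLattice.StabilityFlowTailsProofs
import Literature.MathematicalPhysics.QuantumLattice.StabilityGeneratorInteractionProofs
import Literature.MathematicalPhysics.QuantumLattice.PerturbedDynamicsProofs
import Literature.MathematicalPhysics.QuantumLattice.FlowDisplacementProofs
import Literature.MathematicalPhysics.QuantumLattice.TorusFlowLocalityProofs
import Literature.MathematicalPhysics.QuantumLattice.StabilityDecayCalculusProofs
import HarnessLib

/-!
# The Michalakis–Zwolak stability theorem (hubbard.S19): discharge of `michalakis_zwolak`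

Final file (seat A) of the formalisation of MZ13 Theorem 1
(`Literature.MathematicalPhysics.QuantumLattice.michalakis_zwolak`, stated in `LiebRobinson.lean`):
`michalakis_zwolak_holds`. The top-down reduction `michalakis_zwolak_of_tail_core` (seat B:
MZ13 §6–§7, the `√ε` chain, ball pieces from twirl tails) leaves, for the spectral flow `U` of
`H_t = Σ Φ + t ε Σ V` (handed over through its defining data `U(0) = 1`, `∂_t U = i D(t) U`,
`D(t) = ∫ W(τ) τ_τ^{H_t}(ε Σ V) dτ`, unitarity) and the smoothing maps
`𝓕^s(O) = ∫ w(t) τ_t^{H_s}(O) dt`, `𝓕⁰(O) = ∫ w(t) τ_t^{H₀}(O) dt` of a Schwartz filter `w`, three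
estimates per interaction term, uniform in the volume:

* (A-norm) `‖U(s)⋆ 𝓕^s(Φ Z) U(s) − 𝓕⁰(Φ Z)‖ ≤ |ε| C₀` — `exists_norm_rotated_smoothing_sub_le`:
  `X⁽²⁾ = U⋆ 𝓕^s(O) U − 𝓕^s(O)` by the flow displacement formula
  (`norm_conj_flow_sub_le_integral`) and the commutator of the CENTRED observable `𝓕^s(O)`
  (tails from `exists_smoothing_tail_bound`) with the generator written as a quasi-local
  interaction of local norm `≤ |ε| J₀` (`exists_generator_interaction`,
  `norm_comm_centred_interaction_le`) — MZ13 Lemma 2, arXiv:1109.1588 p. 12; and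
  `X⁽¹⁾ = 𝓕^s(O) − 𝓕⁰(O)` by `norm_smoothing_sub_perturbed_le` (MZ13 Lemma 1 (v), p. 11), made
  uniform in the volume by monotonicity of its constant in the ball cardinality
  (`perturbedConst_mono`);
* (A-tails) `ε`-free power-law tails of the same observable around the centre of `Z` —
  the tails of `U⋆ 𝓕^s(Φ Z) U` by the flow locality of a quasi-local (centred) observable
  (`norm_flow_sub_twirl_quasilocal_le_pow`: split at the scale `ℓ/2`, the local half by
  seat B's `norm_flow_sub_twirl_le_pow` = MZ13 Lemma 2 with the generator interaction of
  `exists_generator_interaction`, the far half by the smoothing tails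
  `exists_smoothing_tail_bound` = MZ13 Lemma 1 (iv)), plus the tails of `𝓕⁰(Φ Z)`;
* (B-tails) the same for `U⋆ 𝓕^s(V Z) U`.

No definitions, no named facts (theorems only).
[cite: MichalakisZwolakCMP2013, Thm. 1, §5.1 Lemma 1 (iv),(v), §5.2 Lemma 2 (arXiv:1109.1588 pp. 5–6, 9–12)]
-/

noncomputable section

open Matrix Complex Finset MeasureTheory
open scoped Nat Matrix.Norms.L2Operator SchwartzMap

namespace Literature.MathematicalPhysics.QuantumLattice

open Literature.Probability.LatticeModels

/-! ### Elementary bounds -/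

section Elementary

/-- Monotonicity of the constant of `norm_smoothing_sub_perturbed_le` in the ball cardinality.
[folklore] -/
theorem perturbedConst_mono {c₀ c₁ Vr a D R0 : ℝ} (hc₀ : 0 ≤ c₀) (hc : c₀ ≤ c₁) (hVr : 0 < Vr)
    (ha : 0 < a) (hD : 0 ≤ D) (hR0 : 0 ≤ R0) (μ : ℝ) (n : ℕ) :
    (R0 + 2 * max 0 (Real.log ((c₀ / Vr + 1) * Real.exp (2 * μ))) / a + D) ^ n ≤
      (R0 + 2 * max 0 (Real.log ((c₁ / Vr + 1) * Real.exp (2 * μ))) / a + D) ^ n := by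
  have h0 : 0 < (c₀ / Vr + 1) * Real.exp (2 * μ) := by positivity
  have h1 : (c₀ / Vr + 1) * Real.exp (2 * μ) ≤ (c₁ / Vr + 1) * Real.exp (2 * μ) :=
    mul_le_mul_of_nonneg_right (by gcongr) (Real.exp_pos _).le
  have h2 : Real.log ((c₀ / Vr + 1) * Real.exp (2 * μ)) ≤ Real.log ((c₁ / Vr + 1) * Real.exp (2 * μ)) :=
    Real.log_le_log h0 h1
  have h4 : max 0 (Real.log ((c₀ / Vr + 1) * Real.exp (2 * μ))) ≤
      max 0 (Real.log ((c₁ / Vr + 1) * Real.exp (2 * μ))) := max_le_max le_rfl h2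
  have hm0 : 0 ≤ max 0 (Real.log ((c₀ / Vr + 1) * Real.exp (2 * μ))) := le_max_left _ _
  have hbase : 0 ≤ R0 + 2 * max 0 (Real.log ((c₀ / Vr + 1) * Real.exp (2 * μ))) / a + D := by
    positivity
  refine pow_le_pow_left₀ hbase ?_ n
  have : 2 * max 0 (Real.log ((c₀ / Vr + 1) * Real.exp (2 * μ))) / a ≤
      2 * max 0 (Real.log ((c₁ / Vr + 1) * Real.exp (2 * μ))) / a :=
    div_le_div_of_nonneg_right (by linarith) ha.le
  linarith

/-- The unweighted local norm is at most the size-weighted one (`1 ≤ |Z|` for `Z ∋ y`).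
[folklore] -/
theorem sum_norm_le_sum_card_mul_norm {Λ : Type*} [Fintype Λ] [DecidableEq Λ] {q : ℕ}
    (Ψ : Interaction Λ q) (y : Λ) :
    ∑ Z ∈ univ.filter (fun Z : Finset Λ => y ∈ Z), ‖Ψ Z‖ ≤
      ∑ Z ∈ univ.filter (fun Z : Finset Λ => y ∈ Z), (#Z : ℝ) * ‖Ψ Z‖ := by
  refine sum_le_sum fun Z hZ => ?_
  simp only [mem_filter, mem_univ, true_and] at hZ
  have h1 : (1 : ℝ) ≤ #Z := by exact_mod_cast Finset.card_pos.mpr ⟨y, hZ⟩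
  calc ‖Ψ Z‖ = 1 * ‖Ψ Z‖ := (one_mul _).symm
    _ ≤ (#Z : ℝ) * ‖Ψ Z‖ := mul_le_mul_of_nonneg_right h1 (norm_nonneg _)

end Elementary

/-! ### The estimate -/

section Main

variable (d : ℕ) (κ : Type*) [Fintype κ] [DecidableEq κ] (q : ℕ)

set_option maxHeartbeats 800000 in
/-- **`U(s)⋆ 𝓕^s(O) U(s) − 𝓕⁰(O)` is `O(ε)`, uniformly in the volume** (MZ13 Lemma 1 (v) and
Lemma 2, norm part; the first conjunct of the hypothesis of `michalakis_zwolak_of_tail_core`).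
See the module docstring. [cite: MichalakisZwolakCMP2013, §5.1 Lemma 1 (v), §5.2 Lemma 2 (arXiv:1109.1588 pp. 9–12)] -/
theorem exists_norm_rotated_smoothing_sub_le {w : ℝ → ℂ} (hw : Integrable w)
    (hwmom : ∀ k : ℕ, Integrable fun t : ℝ => ‖t‖ ^ k * ‖w t‖)
    {W : ℝ → ℂ} (hWi : Integrable W) (hWmomi : ∀ k : ℕ, Integrable fun t : ℝ => ‖t‖ ^ k * ‖W t‖)
    (hWr : ∀ t : ℝ, starRingEnd ℂ (W t) = W t) (r₀ r : ℕ) :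
    ∃ C₀ : ℝ, 0 ≤ C₀ ∧ ∀ {L : ℕ} [NeZero L] {Φ V : Interaction (TorusSite d L × κ) q},
      Φ.IsLocal → (∀ Z, r₀ < torusDiam Z → Φ Z = 0) → (∀ Z, ‖Φ Z‖ ≤ 1) → V.IsLocal →
      (∀ Z, r < torusDiam Z → V Z = 0) → (∀ Z, ‖V Z‖ ≤ 1) → ∀ {ε : ℝ}, |ε| ≤ 1 →
      ∀ {s : ℝ}, s ∈ Set.Icc (0 : ℝ) 1 → ∀ {U : ℝ → Op (TorusSite d L × κ) q}, U 0 = 1 →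
      (∀ t ∈ Set.Icc (0 : ℝ) s, HasDerivWithinAt U
        (((Complex.I : ℂ) • ∫ τ : ℝ, W τ • heisenbergEvolution
            (∑ Z, Φ Z + t • ((ε : ℂ) • ∑ Z, V Z)) τ ((ε : ℂ) • ∑ Z, V Z)) * U t)
        (Set.Icc 0 s) t) →
      (∀ t ∈ Set.Icc (0 : ℝ) s, (U t)ᴴ * U t = 1) → (∀ t ∈ Set.Icc (0 : ℝ) s, U t * (U t)ᴴ = 1) →
      ∀ (x : TorusSite d L) {O : Op (TorusSite d L × κ) q}, IsSupportedOn O (cellBall x r₀) →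
      ‖O‖ ≤ 1 →
      ‖star (U s) * (∫ t : ℝ, w t • heisenbergEvolution
          (∑ Z, Φ Z + s • ((ε : ℂ) • ∑ Z, V Z)) t O) * U s -
        ∫ t : ℝ, w t • heisenbergEvolution (∑ Z, Φ Z) t O‖ ≤ |ε| * C₀ := by
  classical
  -- uniform constants: the generator as an interaction, the smoothing tails, moments of `w`
  obtain ⟨J₀, hJ₀1, _K, -, hgen⟩ := exists_generator_interaction d κ q hWi hWmomi hWr r₀ r
  obtain ⟨Csm, hCsm0, hsm⟩ := exists_smoothing_tail_bound d κ q hw hwmom r₀ r r₀ (d + 2)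
  have hJ₀0 : (0 : ℝ) ≤ J₀ := zero_le_one.trans hJ₀1
  set Nw : ℝ := ∫ t : ℝ, ‖w t‖ with hNw
  have hNw0 : 0 ≤ Nw := integral_nonneg fun t => norm_nonneg _
  set M₁ : ℝ := ∫ t : ℝ, ‖w t‖ * |t| with hM₁
  set Md : ℝ := ∫ t : ℝ, ‖w t‖ * |t| ^ (d + 2) with hMd
  have hM₁0 : 0 ≤ M₁ := integral_nonneg fun t => by positivity
  have hMd0 : 0 ≤ Md := integral_nonneg fun t => by positivity
  -- ball counting
  set Nb : ℕ := (2 * r₀ + 1) ^ d * Fintype.card κ with hNb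
  set Vc : ℕ := (2 * r₀ + 1) ^ d * Fintype.card κ + 1 with hVc
  have hVc1 : 1 ≤ Vc := Nat.le_add_left 1 _
  have hVcr : (0 : ℝ) < (Vc : ℝ) := by exact_mod_cast hVc1
  set JΦ : ℝ := (2 : ℝ) ^ ((2 * r₀ + 1) ^ d * Fintype.card κ) with hJΦ
  have hJΦ0 : 0 ≤ JΦ := by positivity
  -- the two constants
  set Cflow : ℝ := 2 * J₀ * (Nw * Nb + 4 * Csm * ((2 * (r₀ : ℝ) + 3) ^ d * Fintype.card κ)) with hCflow
  have hCflow0 : 0 ≤ Cflow := by positivity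
  set a : ℝ := (1 : ℝ) / ((r₀ : ℝ) + 1) with ha
  have ha0 : 0 < a := by positivity
  set D : ℝ := (Nat.factorial d : ℝ) * (6 / a) ^ d * (2 / a) with hD
  have hD0 : 0 ≤ D := by positivity
  set A : ℝ := (2 : ℝ) ^ ((2 * r + 1) ^ d * Fintype.card κ) * Fintype.card κ with hA
  have hA0 : 0 ≤ A := by positivity
  set PN : ℝ := (2 * (r₀ : ℝ) + 3 + 2 * max 0 (Real.log (((Nb : ℝ) / Vc + 1) * Real.exp (2 * 1))) / a + D) ^
    (d + 1) with hPN
  have hPN0 : 0 ≤ PN := by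
    have : 0 ≤ max 0 (Real.log (((Nb : ℝ) / Vc + 1) * Real.exp (2 * 1))) := le_max_left _ _
    positivity
  set Q : ℝ := 2 ^ (d + 1) * (2 * (2 * Real.exp 1 * Vc * JΦ) / a) ^ (d + 1) with hQ
  have hQ0 : 0 ≤ Q := by positivity
  set Cdyn : ℝ := 2 * (M₁ * (1 + A * (2 ^ (d + 1) * PN)) + A * Q * Md) with hCdyn
  have hCdyn0 : 0 ≤ Cdyn := by positivity
  refine ⟨Cflow + Cdyn, add_nonneg hCflow0 hCdyn0, ?_⟩
  intro L _ Φ V hΦ hΦr hΦn hV hVr hVn ε hε s hs U hU0 hUd hU1 hU2 x O hO hO1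
  have hs0 : 0 ≤ s := hs.1
  have hs1 : s ≤ 1 := hs.2
  have hε0 : 0 ≤ |ε| := abs_nonneg ε
  have hsmem : s ∈ Set.Icc (0 : ℝ) s := ⟨hs0, le_rfl⟩
  -- the generator as an interaction and the flow data in that format (before any abbreviation)
  obtain ⟨Ψ, hΨloc, hΨc, hΨH, hΨJ, -⟩ := hgen hΦ hΦr hΦn hV hVr hVn hε
  have hU' : ∀ t ∈ Set.Icc (0 : ℝ) s,
      HasDerivWithinAt U (((Complex.I : ℂ) • localHamiltonian (Ψ t) univ) * U t) (Set.Icc 0 s) t := by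
    intro t ht
    have h := hUd t ht
    rwa [← hΨH t] at h
  have hDgc : ContinuousOn (fun t => localHamiltonian (Ψ t) univ) (Set.Icc 0 s) := by
    have hfun : (fun t => localHamiltonian (Ψ t) univ) = fun t => ∑ Z, Ψ t Z :=
      funext fun t => localHamiltonian_univ_eq_sum _
    rw [hfun]
    exact (continuous_finsetSum _ fun Z _ => hΨc Z).continuousOn
  have hDgh : ∀ t ∈ Set.Icc (0 : ℝ) s, (localHamiltonian (Ψ t) univ).IsHermitian := fun t _ =>
    localHamiltonian_isHermitian (hΨloc t) univ
  -- Hamiltonians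
  set H₀ : Op (TorusSite d L × κ) q := ∑ Z, Φ Z with hH₀def
  set Hs : Op (TorusSite d L × κ) q := ∑ Z, Φ Z + s • ((ε : ℂ) • ∑ Z, V Z) with hHsdef
  have hH₀eq : localHamiltonian Φ univ = H₀ := localHamiltonian_univ_eq_sum _
  have hVeq : localHamiltonian V univ = ∑ Z, V Z := localHamiltonian_univ_eq_sum _
  have hH₀h : H₀.IsHermitian := by rw [← hH₀eq]; exact localHamiltonian_isHermitian hΦ univ
  have hV₁h : (∑ Z, V Z).IsHermitian := by rw [← hVeq]; exact localHamiltonian_isHermitian hV univ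
  have hHsh : Hs.IsHermitian :=
    hH₀h.add ((isHermitian_ofReal_smul hV₁h ε).smul (IsSelfAdjoint.all s))
  have hHs_c : (∑ Z, Φ Z + ((s * ε : ℝ) : ℂ) • ∑ Z, V Z) = Hs := by
    rw [hHsdef, ← Complex.coe_smul, smul_smul, ← Complex.ofReal_mul]
  have hHs_c' : localHamiltonian Φ univ - ((-(s * ε) : ℝ) : ℂ) • localHamiltonian V univ = Hs := by
    rw [hH₀eq, hVeq, ← hHs_c, hH₀def, Complex.ofReal_neg, neg_smul, sub_neg_eq_add]
  have hcε : |s * ε| ≤ 1 := by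
    rw [abs_mul, abs_of_nonneg hs0]
    calc s * |ε| ≤ 1 * 1 := mul_le_mul hs1 hε hε0 zero_le_one
      _ = 1 := one_mul _
  -- the smoothed observables
  set F : Op (TorusSite d L × κ) q := ∫ t : ℝ, w t • heisenbergEvolution Hs t O with hFdef
  set F0 : Op (TorusSite d L × κ) q := ∫ t : ℝ, w t • heisenbergEvolution H₀ t O with hF0def
  have hFnorm : ‖F‖ ≤ Nw := by
    calc ‖F‖ ≤ Nw * ‖O‖ := norm_integral_smul_heisenbergEvolution_le hHsh w O
      _ ≤ Nw * 1 := mul_le_mul_of_nonneg_left hO1 hNw0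
      _ = Nw := mul_one _
  -- Part 1: `X⁽²⁾ = U⋆ F U − F`, via the flow displacement and the generator interaction
  have hpart1 : ‖(U s)ᴴ * F * U s - F‖ ≤ |ε| * Cflow := by
    have h1 := norm_conj_flow_sub_le_integral hDgc hDgh hU0 hU' hU1 hU2 F hsmem
    refine h1.trans ?_
    -- uniform bound of the integrand on `[0, s]`
    have hbound : ∀ σ ∈ Set.uIoc (0 : ℝ) s,
        ‖(‖F * localHamiltonian (Ψ σ) univ - localHamiltonian (Ψ σ) univ * F‖)‖ ≤ |ε| * Cflow := by
      intro σ hσ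
      rw [Real.norm_eq_abs, abs_of_nonneg (norm_nonneg _)]
      have hσ' : σ ∈ Set.Icc (0 : ℝ) s := by
        rw [Set.uIoc_of_le hs0] at hσ; exact ⟨hσ.1.le, hσ.2⟩
      have hσ1 : |σ| ≤ 1 := by rw [abs_of_nonneg hσ'.1]; exact hσ'.2.trans hs1
      -- local norm of `Ψ σ`
      have hJσ : ∀ y : TorusSite d L × κ,
          ∑ Z ∈ univ.filter (fun Z : Finset (TorusSite d L × κ) => y ∈ Z), ‖Ψ σ Z‖ ≤ |ε| * J₀ :=
        fun y => (sum_norm_le_sum_card_mul_norm (Ψ σ) y).trans (hΨJ σ hσ1 y)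
      -- tails of `F` on the chain of balls
      have hcent : ∀ k : ℕ, ‖F - twirl (cellBall x (r₀ + k) : Finset (TorusSite d L × κ))ᶜ F‖ ≤
          Csm / ((k : ℝ) + 1) ^ (d + 2) := by
        intro k
        have h := hsm hΦ hΦr hΦn hV hVr hVn hcε x hO k
        rw [hHs_c] at h
        calc _ ≤ ‖O‖ * (Csm / ((k : ℝ) + 1) ^ (d + 2)) := h
          _ ≤ 1 * (Csm / ((k : ℝ) + 1) ^ (d + 2)) :=
              mul_le_mul_of_nonneg_right hO1 (by positivity)
          _ = _ := one_mul _
      have hmono : Monotone fun k : ℕ => (cellBall x (r₀ + k) : Finset (TorusSite d L × κ)) :=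
        fun k₁ k₂ hk => cellBall_mono x (by omega)
      have huniv : (cellBall x (r₀ + L) : Finset (TorusSite d L × κ)) = Finset.univ :=
        cellBall_eq_univ (x := x) (by omega)
      have hcomm := norm_comm_centred_interaction_le (hΨloc σ) hJσ
        (fun k : ℕ => (cellBall x (r₀ + k) : Finset (TorusSite d L × κ))) hmono huniv F hcent
      rw [localHamiltonian_univ_eq_sum]
      refine hcomm.trans ?_
      -- evaluate the right-hand side
      have hS0 : (#(cellBall x (r₀ + 0) : Finset (TorusSite d L × κ)) : ℝ) ≤ Nb := by
        rw [add_zero, hNb]; exact_mod_cast card_cellBall_le x r₀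
      have hterm : ∀ k ∈ range L,
          (Csm / (((k + 1 : ℕ) : ℝ) + 1) ^ (d + 2) + Csm / ((k : ℝ) + 1) ^ (d + 2)) *
            (#(cellBall x (r₀ + (k + 1)) : Finset (TorusSite d L × κ)) : ℝ) ≤
          2 * Csm * ((2 * (r₀ : ℝ) + 3) ^ d * Fintype.card κ) * (1 / ((k : ℝ) + 1) ^ 2) := by
        intro k _
        have hk1 : (0 : ℝ) < (k : ℝ) + 1 := by positivity
        -- the two tails
        have hE1 : Csm / (((k + 1 : ℕ) : ℝ) + 1) ^ (d + 2) ≤ Csm / ((k : ℝ) + 1) ^ (d + 2) := by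
          refine div_le_div_of_nonneg_left hCsm0 (by positivity) ?_
          exact pow_le_pow_left₀ hk1.le (by push_cast; linarith) _
        -- the ball
        have hball : (#(cellBall x (r₀ + (k + 1)) : Finset (TorusSite d L × κ)) : ℝ) ≤
            ((2 * (r₀ : ℝ) + 3) ^ d * Fintype.card κ) * ((k : ℝ) + 1) ^ d := by
          have h1 := card_cellBall_le (κ := κ) x (r₀ + (k + 1))
          have h2 : (#(cellBall x (r₀ + (k + 1)) : Finset (TorusSite d L × κ)) : ℝ) ≤
              (((2 * (r₀ + (k + 1)) + 1) ^ d * Fintype.card κ : ℕ) : ℝ) := by exact_mod_cast h1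
          refine h2.trans ?_
          have h3' : 2 * (r₀ + (k + 1)) + 1 ≤ (2 * r₀ + 3) * (k + 1) := by nlinarith [Nat.zero_le (r₀ * k)]
          have h3 : ((2 * (r₀ + (k + 1)) + 1 : ℕ) : ℝ) ≤ (2 * (r₀ : ℝ) + 3) * ((k : ℝ) + 1) := by
            exact_mod_cast h3'
          calc (((2 * (r₀ + (k + 1)) + 1) ^ d * Fintype.card κ : ℕ) : ℝ)
              = ((2 * (r₀ + (k + 1)) + 1 : ℕ) : ℝ) ^ d * Fintype.card κ := by
                rw [Nat.cast_mul, Nat.cast_pow]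
            _ ≤ ((2 * (r₀ : ℝ) + 3) * ((k : ℝ) + 1)) ^ d * Fintype.card κ :=
                mul_le_mul_of_nonneg_right (pow_le_pow_left₀ (by positivity) h3 d) (Nat.cast_nonneg _)
            _ = _ := by rw [mul_pow]; ring
        have hsum2 : Csm / (((k + 1 : ℕ) : ℝ) + 1) ^ (d + 2) + Csm / ((k : ℝ) + 1) ^ (d + 2) ≤
            2 * (Csm / ((k : ℝ) + 1) ^ (d + 2)) := by linarith
        calc _ ≤ (2 * (Csm / ((k : ℝ) + 1) ^ (d + 2))) *
              (((2 * (r₀ : ℝ) + 3) ^ d * Fintype.card κ) * ((k : ℝ) + 1) ^ d) :=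
              mul_le_mul hsum2 hball (Nat.cast_nonneg _) (by positivity)
          _ = 2 * Csm * ((2 * (r₀ : ℝ) + 3) ^ d * Fintype.card κ) * (1 / ((k : ℝ) + 1) ^ 2) := by
              rw [pow_add]
              field_simp
      have hsum : ∑ k ∈ range L, (Csm / (((k + 1 : ℕ) : ℝ) + 1) ^ (d + 2) + Csm / ((k : ℝ) + 1) ^ (d + 2)) *
          (#(cellBall x (r₀ + (k + 1)) : Finset (TorusSite d L × κ)) : ℝ) ≤
          4 * Csm * ((2 * (r₀ : ℝ) + 3) ^ d * Fintype.card κ) := by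
        refine (sum_le_sum hterm).trans ?_
        rw [← mul_sum]
        calc 2 * Csm * ((2 * (r₀ : ℝ) + 3) ^ d * Fintype.card κ) * ∑ k ∈ range L, 1 / ((k : ℝ) + 1) ^ 2
            ≤ 2 * Csm * ((2 * (r₀ : ℝ) + 3) ^ d * Fintype.card κ) * 2 :=
              mul_le_mul_of_nonneg_left (sum_range_one_div_sq_le_two L) (by positivity)
          _ = _ := by ring
      have hJ00 : 0 ≤ |ε| * J₀ := mul_nonneg hε0 hJ₀0
      calc 2 * (|ε| * J₀) * (‖F‖ * #(cellBall x (r₀ + 0) : Finset (TorusSite d L × κ)) +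
            ∑ k ∈ range L, (Csm / (((k + 1 : ℕ) : ℝ) + 1) ^ (d + 2) + Csm / ((k : ℝ) + 1) ^ (d + 2)) *
              #(cellBall x (r₀ + (k + 1)) : Finset (TorusSite d L × κ)))
          ≤ 2 * (|ε| * J₀) * (Nw * Nb + 4 * Csm * ((2 * (r₀ : ℝ) + 3) ^ d * Fintype.card κ)) := by
            refine mul_le_mul_of_nonneg_left (add_le_add ?_ hsum) (by positivity)
            exact mul_le_mul hFnorm hS0 (Nat.cast_nonneg _) hNw0
        _ = |ε| * Cflow := by rw [hCflow]; ring
    have h2 := intervalIntegral.norm_integral_le_of_norm_le_const hbound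
    rw [sub_zero, abs_of_nonneg hs0] at h2
    calc ∫ σ in (0 : ℝ)..s, ‖F * localHamiltonian (Ψ σ) univ - localHamiltonian (Ψ σ) univ * F‖
        ≤ ‖∫ σ in (0 : ℝ)..s, ‖F * localHamiltonian (Ψ σ) univ - localHamiltonian (Ψ σ) univ * F‖‖ :=
          Real.le_norm_self _
      _ ≤ |ε| * Cflow * s := h2
      _ ≤ |ε| * Cflow * 1 := mul_le_mul_of_nonneg_left hs1 (by positivity)
      _ = |ε| * Cflow := mul_one _
  -- Part 2: `X⁽¹⁾ = F − F0`, via the perturbed dynamics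
  have hpart2 : ‖F0 - F‖ ≤ |ε| * Cdyn := by
    have hJ : ∀ y : TorusSite d L × κ,
        ∑ Z ∈ univ.filter (fun Z : Finset (TorusSite d L × κ) => y ∈ Z), ‖Φ Z‖ ≤ JΦ :=
      fun y => sum_norm_filter_mem_le_two_pow hΦr hΦn y
    have hVsz : ∀ Z, Φ Z ≠ 0 → #Z ≤ Vc := by
      intro Z hZ
      have hdiam : torusDiam Z ≤ r₀ := not_lt.mp fun h => hZ (hΦr Z h)
      exact (card_le_of_torusDiam_le hdiam).trans (Nat.le_succ _)
    have hm1 : Integrable fun t : ℝ => ‖w t‖ * |t| := by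
      refine (hwmom 1).congr (Filter.Eventually.of_forall fun t => ?_)
      simp only [pow_one, Real.norm_eq_abs]; ring
    have hmd : Integrable fun t : ℝ => ‖w t‖ * |t| ^ (d + 2) := by
      refine (hwmom (d + 2)).congr (Filter.Eventually.of_forall fun t => ?_)
      simp only [Real.norm_eq_abs]; ring
    have h := norm_smoothing_sub_perturbed_le hΦ hΦr hJΦ0 hJ hVc1 hVsz hV hVr hVn (-(s * ε)) x hO
      one_pos hw hm1 hmd
    rw [hHs_c', hH₀eq] at h
    refine h.trans ?_
    -- `|−sε| ‖O‖ ≤ |ε|` and the constant is monotone in the ball cardinality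
    have hc1 : |(-(s * ε))| * ‖O‖ ≤ |ε| := by
      rw [abs_neg, abs_mul, abs_of_nonneg hs0]
      calc s * |ε| * ‖O‖ ≤ 1 * |ε| * 1 :=
            mul_le_mul (mul_le_mul_of_nonneg_right hs1 hε0) hO1 (norm_nonneg _) (by positivity)
        _ = |ε| := by ring
    have hcb : (#(cellBall x r₀ : Finset (TorusSite d L × κ)) : ℝ) ≤ Nb := by
      rw [hNb]; exact_mod_cast card_cellBall_le x r₀
    have hmono := perturbedConst_mono (Nat.cast_nonneg _) hcb hVcr ha0 hD0
      (by positivity : (0 : ℝ) ≤ 2 * (r₀ : ℝ) + 3) 1 (d + 1)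
    have hm00 : 0 ≤ max 0 (Real.log (((#(cellBall x r₀ : Finset (TorusSite d L × κ)) : ℝ) / Vc + 1) *
        Real.exp (2 * 1))) := le_max_left _ _
    have hin : M₁ * (A * (2 ^ (d + 1) * (2 * (r₀ : ℝ) + 3 +
        2 * max 0 (Real.log (((#(cellBall x r₀ : Finset (TorusSite d L × κ)) : ℝ) / Vc + 1) *
          Real.exp (2 * 1))) / a + D) ^ (d + 1))) ≤ M₁ * (A * (2 ^ (d + 1) * PN)) :=
      mul_le_mul_of_nonneg_left (mul_le_mul_of_nonneg_left
        (mul_le_mul_of_nonneg_left hmono (by positivity)) hA0) hM₁0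
    have hK : 2 * (M₁ * (1 + A * (2 ^ (d + 1) * (2 * (r₀ : ℝ) + 3 +
        2 * max 0 (Real.log (((#(cellBall x r₀ : Finset (TorusSite d L × κ)) : ℝ) / Vc + 1) *
          Real.exp (2 * 1))) / a + D) ^ (d + 1))) + A * Q * Md) ≤ Cdyn := by
      rw [hCdyn]
      linarith
    exact mul_le_mul hc1 hK (by positivity) hε0
  -- combine
  have hstar : star (U s) = (U s)ᴴ := star_eq_conjTranspose _
  rw [hstar]
  calc ‖(U s)ᴴ * F * U s - F0‖ = ‖((U s)ᴴ * F * U s - F) + (F - F0)‖ := by congr 1; abel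
    _ ≤ ‖(U s)ᴴ * F * U s - F‖ + ‖F - F0‖ := norm_add_le _ _
    _ ≤ |ε| * Cflow + |ε| * Cdyn := add_le_add hpart1 (by rw [norm_sub_rev]; exact hpart2)
    _ = |ε| * (Cflow + Cdyn) := by ring

end Main

/-! ### Flow locality of centred observables, interaction format -/

section CentredFlow

variable {d L : ℕ} [NeZero L] {κ : Type*} [Fintype κ] [DecidableEq κ] {q : ℕ}

/-- **MZ13 Lemma 2 for a centred (quasi-local) observable, power format.** Let `Ψ_t` be local
interactions on the decorated torus generating the unitary flow `U` on `[0, T]` (`T ≤ 1`), with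
size-weighted local norms `≤ a J` (`0 ≤ a ≤ 1 ≤ J`) and long-range parts (diameter `> 2θ`) of
local norm `≤ a K_p/(θ+1)^p` for every `p`. If `‖O‖ ≤ N₀` and `O` is centred at `x` with base
radius `R` and tails `‖O − 𝔼_{b_x(R+m)ᶜ}(O)‖ ≤ C_p/(m+1)^p` (all `m`, `p`), then for `t ∈ [0,T]`
and all `ℓ`, `p`:
`‖α_t(O) − 𝔼_{b_x(R+ℓ)ᶜ}(α_t(O))‖ ≤ (2·2^p C_p + 2 N₀ (2R+1)^d |κ| 2^{p+d} E_{p+d})/(ℓ+1)^p`,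
`E_n = e^{2eJ} (2n)! 9^n + K_{2n} 4^n e^{2J}`, `α_t(O) = U(t)ᴴ O U(t)` (split `O` at the scale
`ℓ/2`; the local half by `norm_flow_sub_twirl_le_pow`).
[cite: MichalakisZwolakCMP2013, §5.2 Lemma 2 (arXiv:1109.1588 p. 12)] -/
theorem norm_flow_sub_twirl_quasilocal_le_pow {Ψ : ℝ → Interaction (TorusSite d L × κ) q}
    (hΨ : ∀ t, (Ψ t).IsLocal) {T : ℝ} (hT1 : T ≤ 1)
    (hΨc : ∀ Z, ContinuousOn (fun t => Ψ t Z) (Set.Icc 0 T)) {U : ℝ → Op (TorusSite d L × κ) q}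
    (hU0 : U 0 = 1)
    (hU : ∀ t ∈ Set.Icc 0 T,
      HasDerivWithinAt U (((I : ℂ) • localHamiltonian (Ψ t) univ) * U t) (Set.Icc 0 T) t)
    (hU1 : ∀ t ∈ Set.Icc 0 T, (U t)ᴴ * U t = 1) (hU2 : ∀ t ∈ Set.Icc 0 T, U t * (U t)ᴴ = 1)
    {J a : ℝ} (hJ1 : 1 ≤ J) (ha0 : 0 ≤ a) (ha1 : a ≤ 1)
    (hJ : ∀ t ∈ Set.Icc 0 T, ∀ y : TorusSite d L × κ,
      ∑ Z ∈ univ.filter (fun Z : Finset (TorusSite d L × κ) => y ∈ Z), (#Z : ℝ) * ‖Ψ t Z‖ ≤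
        a * J)
    {K : ℕ → ℝ} (hK0 : ∀ p, 0 ≤ K p)
    (hK : ∀ (p θ : ℕ), ∀ t ∈ Set.Icc 0 T, ∀ y : TorusSite d L × κ,
      ∑ Z ∈ univ.filter (fun Z : Finset (TorusSite d L × κ) => y ∈ Z),
        ‖(if torusDiam Z ≤ 2 * θ then (0 : Op (TorusSite d L × κ) q) else Ψ t Z)‖ ≤
        a * (K p / ((θ : ℝ) + 1) ^ p))
    (x : TorusSite d L) {R : ℕ} {O : Op (TorusSite d L × κ) q} {N₀ : ℝ} (hO : ‖O‖ ≤ N₀)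
    {C_E : ℕ → ℝ} (hCE0 : ∀ p, 0 ≤ C_E p)
    (hcent : ∀ m p : ℕ,
      ‖O - twirl (cellBall x (R + m) : Finset (TorusSite d L × κ))ᶜ O‖ ≤ C_E p / ((m : ℝ) + 1) ^ p)
    {t : ℝ} (ht : t ∈ Set.Icc 0 T) (ℓ p : ℕ) :
    ‖(U t)ᴴ * O * U t - twirl (cellBall x (R + ℓ) : Finset (TorusSite d L × κ))ᶜ ((U t)ᴴ * O * U t)‖ ≤
      (2 * 2 ^ p * C_E p +
        2 * N₀ * ((2 * (R : ℝ) + 1) ^ d * Fintype.card κ) * 2 ^ (p + d) *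
          (Real.exp (2 * Real.exp 1 * J) * (2 * (p + d))! * 9 ^ (p + d) +
            K (2 * (p + d)) * 4 ^ (p + d) * Real.exp (2 * J))) / ((ℓ : ℝ) + 1) ^ p := by
  set m : ℕ := ℓ / 2 with hm
  have hmℓ : m ≤ ℓ := Nat.div_le_self ℓ 2
  have h2m : 2 * m ≤ ℓ := Nat.mul_div_le ℓ 2
  have hN0 : 0 ≤ N₀ := (norm_nonneg O).trans hO
  have hℓ1 : (0 : ℝ) < (ℓ : ℝ) + 1 := by positivity
  -- the flow constant at exponent `p + d`
  set E : ℝ := Real.exp (2 * Real.exp 1 * J) * (2 * (p + d))! * 9 ^ (p + d) +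
    K (2 * (p + d)) * 4 ^ (p + d) * Real.exp (2 * J) with hE
  have hE0 : 0 ≤ E := by have := hK0 (2 * (p + d)); positivity
  set cb : ℝ := (2 * (R : ℝ) + 1) ^ d * Fintype.card κ with hcb
  have hcb0 : 0 ≤ cb := by positivity
  -- the local half at scale `m`
  set Om : Op (TorusSite d L × κ) q := twirl (cellBall x (R + m) : Finset (TorusSite d L × κ))ᶜ O
    with hOm
  have hOm_supp : IsSupportedOn Om (cellBall x (R + m)) := isSupportedOn_twirl_compl _ O
  have hOm_norm : ‖Om‖ ≤ N₀ := (norm_twirl_le _ O).trans hO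
  have hdiff : ‖O - Om‖ ≤ C_E p / ((m : ℝ) + 1) ^ p := hcent m p
  have hUu : U t ∈ unitary (Op (TorusSite d L × κ) q) :=
    Matrix.mem_unitaryGroup_iff'.mpr (hU1 t ht)
  have hUu' : (U t)ᴴ ∈ unitary (Op (TorusSite d L × κ) q) := by
    rw [← star_eq_conjTranspose]; exact Unitary.star_mem hUu
  -- split
  have hsplit : (U t)ᴴ * O * U t -
      twirl (cellBall x (R + ℓ) : Finset (TorusSite d L × κ))ᶜ ((U t)ᴴ * O * U t) =
      ((U t)ᴴ * (O - Om) * U t -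
        twirl (cellBall x (R + ℓ) : Finset (TorusSite d L × κ))ᶜ ((U t)ᴴ * (O - Om) * U t)) +
      ((U t)ᴴ * Om * U t -
        twirl (cellBall x (R + ℓ) : Finset (TorusSite d L × κ))ᶜ ((U t)ᴴ * Om * U t)) := by
    rw [conj_sub, twirl_sub]; abel
  -- the far half: `α` is isometric, the twirl is contractive
  have hfar : ‖(U t)ᴴ * (O - Om) * U t -
      twirl (cellBall x (R + ℓ) : Finset (TorusSite d L × κ))ᶜ ((U t)ᴴ * (O - Om) * U t)‖ ≤
      2 * 2 ^ p * C_E p / ((ℓ : ℝ) + 1) ^ p := by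
    calc ‖(U t)ᴴ * (O - Om) * U t -
          twirl (cellBall x (R + ℓ) : Finset (TorusSite d L × κ))ᶜ ((U t)ᴴ * (O - Om) * U t)‖
        ≤ ‖(U t)ᴴ * (O - Om) * U t‖ +
            ‖twirl (cellBall x (R + ℓ) : Finset (TorusSite d L × κ))ᶜ ((U t)ᴴ * (O - Om) * U t)‖ :=
          norm_sub_le _ _
      _ ≤ ‖(U t)ᴴ * (O - Om) * U t‖ + ‖(U t)ᴴ * (O - Om) * U t‖ :=
          add_le_add le_rfl (norm_twirl_le _ _)
      _ = 2 * ‖O - Om‖ := by rw [norm_unitary_mul_mul_unitary hUu' hUu]; ring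
      _ ≤ 2 * (C_E p / ((m : ℝ) + 1) ^ p) := by linarith
      _ ≤ 2 * (2 ^ p * C_E p / ((ℓ : ℝ) + 1) ^ p) :=
          mul_le_mul_of_nonneg_left (div_half_pow_le (hCE0 p) p ℓ) (by norm_num)
      _ = 2 * 2 ^ p * C_E p / ((ℓ : ℝ) + 1) ^ p := by ring
  -- the local half: `norm_flow_sub_twirl_le_pow` between the radii `R + m` and `R + ℓ`
  have hloc : ‖(U t)ᴴ * Om * U t -
      twirl (cellBall x (R + ℓ) : Finset (TorusSite d L × κ))ᶜ ((U t)ᴴ * Om * U t)‖ ≤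
      2 * N₀ * cb * 2 ^ (p + d) * E / ((ℓ : ℝ) + 1) ^ p := by
    have hrad : R + ℓ = R + m + (ℓ - m) := by omega
    rw [hrad]
    have h := norm_flow_sub_twirl_le_pow hΨ hT1 hΨc hU0 hU hU1 hU2 hJ1 ha0 ha1 hJ
      (hK0 (2 * (p + d))) (hK (2 * (p + d))) x hOm_supp ht (ℓ - m)
    refine h.trans ?_
    -- the ball at scale `m`
    have hcard : (#(cellBall x (R + m) : Finset (TorusSite d L × κ)) : ℝ) ≤ cb * ((ℓ : ℝ) + 1) ^ d := by
      have h1 := card_cellBall_le (κ := κ) x (R + m)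
      have h2 : (#(cellBall x (R + m) : Finset (TorusSite d L × κ)) : ℝ) ≤
          (((2 * (R + m) + 1) ^ d * Fintype.card κ : ℕ) : ℝ) := by exact_mod_cast h1
      refine h2.trans ?_
      have h3 : 2 * (R + m) + 1 ≤ (2 * R + 1) * (ℓ + 1) := by nlinarith [h2m, Nat.zero_le (R * ℓ)]
      have h4 : ((2 * (R + m) + 1 : ℕ) : ℝ) ≤ (2 * (R : ℝ) + 1) * ((ℓ : ℝ) + 1) := by
        exact_mod_cast h3
      calc (((2 * (R + m) + 1) ^ d * Fintype.card κ : ℕ) : ℝ)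
          = ((2 * (R + m) + 1 : ℕ) : ℝ) ^ d * Fintype.card κ := by rw [Nat.cast_mul, Nat.cast_pow]
        _ ≤ ((2 * (R : ℝ) + 1) * ((ℓ : ℝ) + 1)) ^ d * Fintype.card κ :=
            mul_le_mul_of_nonneg_right (pow_le_pow_left₀ (by positivity) h4 d) (Nat.cast_nonneg _)
        _ = cb * ((ℓ : ℝ) + 1) ^ d := by rw [hcb, mul_pow]; ring
    -- the distance `ℓ - m ≥ ℓ/2`
    have hdist : E / ((((ℓ - m : ℕ) : ℝ)) + 1) ^ (p + d) ≤ E * (2 ^ (p + d) / ((ℓ : ℝ) + 1) ^ (p + d)) := by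
      have hpos : (0 : ℝ) < (((ℓ - m : ℕ) : ℝ)) + 1 := by positivity
      have h1 : 1 / ((((ℓ - m : ℕ) : ℝ)) + 1) ^ (p + d) ≤ 2 ^ (p + d) / ((ℓ : ℝ) + 1) ^ (p + d) := by
        rw [div_le_div_iff₀ (pow_pos hpos _) (pow_pos hℓ1 _), one_mul, ← mul_pow]
        refine pow_le_pow_left₀ hℓ1.le ?_ _
        have h5 : ℓ + 1 ≤ 2 * ((ℓ - m) + 1) := by omega
        have h6 : ((ℓ : ℝ) + 1) ≤ 2 * ((((ℓ - m : ℕ) : ℝ)) + 1) := by exact_mod_cast h5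
        exact h6
      calc E / ((((ℓ - m : ℕ) : ℝ)) + 1) ^ (p + d) = E * (1 / ((((ℓ - m : ℕ) : ℝ)) + 1) ^ (p + d)) := by
            rw [mul_one_div]
        _ ≤ E * (2 ^ (p + d) / ((ℓ : ℝ) + 1) ^ (p + d)) := mul_le_mul_of_nonneg_left h1 hE0
    have hA : 2 * ‖Om‖ * (#(cellBall x (R + m) : Finset (TorusSite d L × κ)) : ℝ) * a ≤
        2 * N₀ * (cb * ((ℓ : ℝ) + 1) ^ d) * 1 := by
      have e1 : 2 * ‖Om‖ ≤ 2 * N₀ := by linarith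
      have e2 : 2 * ‖Om‖ * (#(cellBall x (R + m) : Finset (TorusSite d L × κ)) : ℝ) ≤
          2 * N₀ * (cb * ((ℓ : ℝ) + 1) ^ d) :=
        mul_le_mul e1 hcard (Nat.cast_nonneg _) (by linarith)
      exact mul_le_mul e2 ha1 ha0 (mul_nonneg (by linarith) (by positivity))
    calc 2 * ‖Om‖ * (#(cellBall x (R + m) : Finset (TorusSite d L × κ)) : ℝ) * a *
          (E / ((((ℓ - m : ℕ) : ℝ)) + 1) ^ (p + d))
        ≤ 2 * N₀ * (cb * ((ℓ : ℝ) + 1) ^ d) * 1 * (E * (2 ^ (p + d) / ((ℓ : ℝ) + 1) ^ (p + d))) :=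
          mul_le_mul hA hdist (by positivity) (by rw [mul_one]; exact mul_nonneg (by linarith) (by positivity))
      _ = 2 * N₀ * cb * 2 ^ (p + d) * E / ((ℓ : ℝ) + 1) ^ p := by
          rw [pow_add ((ℓ : ℝ) + 1) p d]
          field_simp
  rw [hsplit]
  calc ‖((U t)ᴴ * (O - Om) * U t -
          twirl (cellBall x (R + ℓ) : Finset (TorusSite d L × κ))ᶜ ((U t)ᴴ * (O - Om) * U t)) +
        ((U t)ᴴ * Om * U t -
          twirl (cellBall x (R + ℓ) : Finset (TorusSite d L × κ))ᶜ ((U t)ᴴ * Om * U t))‖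
      ≤ ‖(U t)ᴴ * (O - Om) * U t -
          twirl (cellBall x (R + ℓ) : Finset (TorusSite d L × κ))ᶜ ((U t)ᴴ * (O - Om) * U t)‖ +
        ‖(U t)ᴴ * Om * U t -
          twirl (cellBall x (R + ℓ) : Finset (TorusSite d L × κ))ᶜ ((U t)ᴴ * Om * U t)‖ :=
        norm_add_le _ _
    _ ≤ 2 * 2 ^ p * C_E p / ((ℓ : ℝ) + 1) ^ p + 2 * N₀ * cb * 2 ^ (p + d) * E / ((ℓ : ℝ) + 1) ^ p :=
        add_le_add hfar hloc
    _ = (2 * 2 ^ p * C_E p + 2 * N₀ * cb * 2 ^ (p + d) * E) / ((ℓ : ℝ) + 1) ^ p := by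
        rw [add_div]

end CentredFlow

/-! ### The discharge -/

section Final

universe u

variable (d q : ℕ) {κ : Type u} [Fintype κ] [DecidableEq κ]

set_option maxHeartbeats 1600000 in
/-- **Michalakis–Zwolak stability of frustration-free gapped Hamiltonians with LTQO (hubbard.S19,
MZ13 Theorem 1)**: discharge of the named fact `michalakis_zwolak`. Assembled from seat B's
reduction `michalakis_zwolak_of_tail_core` (MZ13 §6–§7 and the `√ε` envelope chain) and the
analytic estimates of MZ13 §5: the `O(ε)` norm bound `exists_norm_rotated_smoothing_sub_le`
(Lemma 1 (v) + Lemma 2), the smoothing tails `exists_smoothing_tail_bound` (Lemma 1 (iv)), the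
quasi-local generator `exists_generator_interaction` and the flow locality
`norm_flow_sub_twirl_quasilocal_le_pow` (Lemma 2).
[cite: MichalakisZwolakCMP2013, Thm. 1 (arXiv:1109.1588 pp. 5–6, 15–16)] -/
theorem michalakis_zwolak_holds : michalakis_zwolak (κ := κ) d q := by
  classical
  refine michalakis_zwolak_of_tail_core d q ?_
  intro Φ m γ r₀ Δ γloc hproj _ hrange _ _ _ _ _ r V hV w _ _ _ W _ _ hWmomi hWi _ hWr
  have hwi : Integrable (fun t : ℝ => w t) := w.integrable
  have hwmom : ∀ k : ℕ, Integrable fun t : ℝ => ‖t‖ ^ k * ‖w t‖ := fun k =>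
    w.integrable_pow_mul volume k
  -- uniform constants
  obtain ⟨C₀, hC₀0, hnorm⟩ := exists_norm_rotated_smoothing_sub_le d κ q hwi hwmom hWi hWmomi hWr r₀ r
  obtain ⟨J₀, hJ₀1, Kg, hKg0, hgen⟩ := exists_generator_interaction d κ q hWi hWmomi hWr r₀ r
  choose CA hCA0 hsmA using fun p : ℕ => exists_smoothing_tail_bound d κ q hwi hwmom r₀ r r₀ p
  choose CB hCB0 hsmB using fun p : ℕ => exists_smoothing_tail_bound d κ q hwi hwmom r₀ r r p
  set Nw : ℝ := ∫ t : ℝ, ‖w t‖ with hNw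
  have hNw0 : 0 ≤ Nw := integral_nonneg fun t => norm_nonneg _
  -- the flow constants `E n` and the tail constants
  obtain ⟨E, hE⟩ : ∃ f : ℕ → ℝ, f = fun n => Real.exp (2 * Real.exp 1 * J₀) * (2 * n)! * 9 ^ n +
      Kg (2 * n) * 4 ^ n * Real.exp (2 * J₀) := ⟨_, rfl⟩
  have hE0 : ∀ n, 0 ≤ E n := fun n => by simp only [hE]; have := hKg0 (2 * n); positivity
  obtain ⟨TA, hTA⟩ : ∃ f : ℕ → ℝ, f = fun p => 2 * 2 ^ p * CA p +
      2 * Nw * ((2 * (r₀ : ℝ) + 1) ^ d * Fintype.card κ) * 2 ^ (p + d) * E (p + d) := ⟨_, rfl⟩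
  obtain ⟨TB, hTB⟩ : ∃ f : ℕ → ℝ, f = fun p => 2 * 2 ^ p * CB p +
      2 * Nw * ((2 * (r : ℝ) + 1) ^ d * Fintype.card κ) * 2 ^ (p + d) * E (p + d) := ⟨_, rfl⟩
  have hTA0 : ∀ p, 0 ≤ TA p := fun p => by
    simp only [hTA]; have := hCA0 p; have := hE0 (p + d); positivity
  have hTB0 : ∀ p, 0 ≤ TB p := fun p => by
    simp only [hTB]; have := hCB0 p; have := hE0 (p + d); positivity
  refine ⟨1, fun p => C₀ + TA p + CA p + TB p, fun p => ?_, ?_⟩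
  · have := hTA0 p; have := hTB0 p; have := hCA0 p; positivity
  intro ε hε L _ _ s hs _ U hU0 hUd hU1 hU2
  have hs0 : 0 ≤ s := hs.1
  have hs1 : s ≤ 1 := hs.2
  have hε0 : 0 ≤ |ε| := abs_nonneg ε
  -- the data on this torus
  have hΦloc : (Φ L).IsLocal := (hproj L).2
  have hΦn : ∀ Z, ‖Φ L Z‖ ≤ 1 := fun Z =>
    norm_le_one_of_isHermitian_of_isIdempotentElem ((hproj L).1 Z).1 ((hproj L).1 Z).2
  have hΦr : ∀ Z : Finset (TorusSite d L × κ), r₀ < torusDiam Z → Φ L Z = 0 := fun Z h => hrange L Z h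
  obtain ⟨hVloc, hVr, hVn⟩ := hV L
  -- the generator as an interaction, and the flow data in that format
  obtain ⟨Ψ, hΨloc, hΨc, hΨH, hΨJ, hΨK⟩ := hgen hΦloc hΦr hΦn hVloc hVr hVn hε
  have hU' : ∀ t ∈ Set.Icc (0 : ℝ) s,
      HasDerivWithinAt U (((I : ℂ) • localHamiltonian (Ψ t) univ) * U t) (Set.Icc 0 s) t := by
    intro t ht
    have h := hUd t ht
    rwa [← hΨH t] at h
  have hΨc' : ∀ Z, ContinuousOn (fun t => Ψ t Z) (Set.Icc 0 s) := fun Z => (hΨc Z).continuousOn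
  have habs : ∀ t ∈ Set.Icc (0 : ℝ) s, |t| ≤ 1 := fun t ht => by
    rw [abs_of_nonneg ht.1]; exact ht.2.trans hs1
  have hJ' : ∀ t ∈ Set.Icc (0 : ℝ) s, ∀ y : TorusSite d L × κ,
      ∑ Z ∈ univ.filter (fun Z : Finset (TorusSite d L × κ) => y ∈ Z), (#Z : ℝ) * ‖Ψ t Z‖ ≤
        |ε| * J₀ := fun t ht y => hΨJ t (habs t ht) y
  have hK' : ∀ (p θ : ℕ), ∀ t ∈ Set.Icc (0 : ℝ) s, ∀ y : TorusSite d L × κ,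
      ∑ Z ∈ univ.filter (fun Z : Finset (TorusSite d L × κ) => y ∈ Z),
        ‖(if torusDiam Z ≤ 2 * θ then (0 : Op (TorusSite d L × κ) q) else Ψ t Z)‖ ≤
        |ε| * (Kg p / ((θ : ℝ) + 1) ^ p) := fun p θ t ht y => hΨK p θ t (habs t ht) y
  have hsmem : s ∈ Set.Icc (0 : ℝ) s := ⟨hs0, le_rfl⟩
  -- Hamiltonians
  set H₀' : Op (TorusSite d L × κ) q := ∑ Z, Φ L Z with hH₀'def
  set Hs : Op (TorusSite d L × κ) q := ∑ Z, Φ L Z + s • ((ε : ℂ) • ∑ Z, V L Z) with hHsdef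
  have hH₀'h : H₀'.IsHermitian := by
    rw [hH₀'def, ← localHamiltonian_univ_eq_sum]; exact localHamiltonian_isHermitian hΦloc univ
  have hV₁h : (∑ Z, V L Z).IsHermitian := by
    rw [← localHamiltonian_univ_eq_sum]; exact localHamiltonian_isHermitian hVloc univ
  have hHsh : Hs.IsHermitian :=
    hH₀'h.add ((isHermitian_ofReal_smul hV₁h ε).smul (IsSelfAdjoint.all s))
  have hHs_c : (∑ Z, Φ L Z + ((s * ε : ℝ) : ℂ) • ∑ Z, V L Z) = Hs := by
    rw [hHsdef, ← Complex.coe_smul, smul_smul, ← Complex.ofReal_mul]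
  have hH₀_c : (∑ Z, Φ L Z + ((0 : ℝ) : ℂ) • ∑ Z, V L Z) = H₀' := by
    rw [hH₀'def, Complex.ofReal_zero, zero_smul, add_zero]
  have hcε : |s * ε| ≤ 1 := by
    rw [abs_mul, abs_of_nonneg hs0]
    calc s * |ε| ≤ 1 * 1 := mul_le_mul hs1 hε hε0 zero_le_one
      _ = 1 := one_mul _
  have hc0 : |(0 : ℝ)| ≤ 1 := by rw [abs_zero]; exact zero_le_one
  have hstar : star (U s) = (U s)ᴴ := star_eq_conjTranspose _
  have hpow : ∀ ℓ p : ℕ, (0 : ℝ) < ((ℓ : ℝ) + 1) ^ p := fun ℓ p => by positivity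
  refine ⟨fun Z x _ hZx => ⟨?_, fun ℓ p => ?_⟩, fun Z x _ hZx ℓ p => ?_⟩
  · -- (A-norm)
    have hO : IsSupportedOn (Φ L Z) (cellBall x r₀) :=
      IsSupportedOn.mono_holds (hΦloc.isSupportedOn Z) hZx
    have h := hnorm hΦloc hΦr hΦn hVloc hVr hVn hε hs hU0 hUd hU1 hU2 x hO (hΦn Z)
    have key : C₀ ≤ C₀ + TA 0 + CA 0 + TB 0 := by
      have := hTA0 0; have := hTB0 0; have := hCA0 0
      linarith
    exact h.trans (mul_le_mul_of_nonneg_left key hε0)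
  · -- (A-tails)
    have hO : IsSupportedOn (Φ L Z) (cellBall x r₀) :=
      IsSupportedOn.mono_holds (hΦloc.isSupportedOn Z) hZx
    set F : Op (TorusSite d L × κ) q := ∫ t : ℝ, w t • heisenbergEvolution Hs t (Φ L Z) with hFdef
    set F0 : Op (TorusSite d L × κ) q := ∫ t : ℝ, w t • heisenbergEvolution H₀' t (Φ L Z) with hF0def
    set S : Finset (TorusSite d L × κ) := (cellBall x (r₀ + ℓ) : Finset (TorusSite d L × κ))ᶜ with hS
    have hFn : ‖F‖ ≤ Nw := by
      calc ‖F‖ ≤ Nw * ‖Φ L Z‖ := norm_integral_smul_heisenbergEvolution_le hHsh _ _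
        _ ≤ Nw * 1 := mul_le_mul_of_nonneg_left (hΦn Z) hNw0
        _ = Nw := mul_one _
    have hcentA : ∀ m' p' : ℕ,
        ‖F - twirl (cellBall x (r₀ + m') : Finset (TorusSite d L × κ))ᶜ F‖ ≤ CA p' / ((m' : ℝ) + 1) ^ p' := by
      intro m' p'
      have h := hsmA p' hΦloc hΦr hΦn hVloc hVr hVn hcε x hO m'
      rw [hHs_c] at h
      calc _ ≤ ‖Φ L Z‖ * (CA p' / ((m' : ℝ) + 1) ^ p') := h
        _ ≤ 1 * (CA p' / ((m' : ℝ) + 1) ^ p') :=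
            mul_le_mul_of_nonneg_right (hΦn Z) (div_nonneg (hCA0 p') (by positivity))
        _ = _ := one_mul _
    have hG := norm_flow_sub_twirl_quasilocal_le_pow hΨloc hs1 hΨc' hU0 hU' hU1 hU2 hJ₀1 hε0 hε hJ'
      hKg0 hK' x hFn hCA0 hcentA hsmem ℓ p
    have hG' : ‖(U s)ᴴ * F * U s - twirl S ((U s)ᴴ * F * U s)‖ ≤ TA p / ((ℓ : ℝ) + 1) ^ p := by
      refine hG.trans (le_of_eq ?_)
      rw [hTA, hE]
    have hG0 : ‖F0 - twirl S F0‖ ≤ CA p / ((ℓ : ℝ) + 1) ^ p := by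
      have h := hsmA p hΦloc hΦr hΦn hVloc hVr hVn hc0 x hO ℓ
      rw [hH₀_c] at h
      calc _ ≤ ‖Φ L Z‖ * (CA p / ((ℓ : ℝ) + 1) ^ p) := h
        _ ≤ 1 * (CA p / ((ℓ : ℝ) + 1) ^ p) :=
            mul_le_mul_of_nonneg_right (hΦn Z) (div_nonneg (hCA0 p) (by positivity))
        _ = _ := one_mul _
    rw [hstar]
    calc ‖(U s)ᴴ * F * U s - F0 - twirl S ((U s)ᴴ * F * U s - F0)‖
        = ‖((U s)ᴴ * F * U s - twirl S ((U s)ᴴ * F * U s)) - (F0 - twirl S F0)‖ := by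
          rw [twirl_sub]; congr 1; abel
      _ ≤ ‖(U s)ᴴ * F * U s - twirl S ((U s)ᴴ * F * U s)‖ + ‖F0 - twirl S F0‖ := norm_sub_le _ _
      _ ≤ TA p / ((ℓ : ℝ) + 1) ^ p + CA p / ((ℓ : ℝ) + 1) ^ p := add_le_add hG' hG0
      _ = (TA p + CA p) / ((ℓ : ℝ) + 1) ^ p := by rw [add_div]
      _ ≤ (C₀ + TA p + CA p + TB p) / ((ℓ : ℝ) + 1) ^ p := by
          refine div_le_div_of_nonneg_right ?_ (hpow ℓ p).le
          have := hTB0 p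
          linarith
  · -- (B-tails)
    have hO : IsSupportedOn (V L Z) (cellBall x r) :=
      IsSupportedOn.mono_holds (hVloc.isSupportedOn Z) hZx
    set F : Op (TorusSite d L × κ) q := ∫ t : ℝ, w t • heisenbergEvolution Hs t (V L Z) with hFdef
    set S : Finset (TorusSite d L × κ) := (cellBall x (r + ℓ) : Finset (TorusSite d L × κ))ᶜ with hS
    have hFn : ‖F‖ ≤ Nw := by
      calc ‖F‖ ≤ Nw * ‖V L Z‖ := norm_integral_smul_heisenbergEvolution_le hHsh _ _
        _ ≤ Nw * 1 := mul_le_mul_of_nonneg_left (hVn Z) hNw0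
        _ = Nw := mul_one _
    have hcentB : ∀ m' p' : ℕ,
        ‖F - twirl (cellBall x (r + m') : Finset (TorusSite d L × κ))ᶜ F‖ ≤ CB p' / ((m' : ℝ) + 1) ^ p' := by
      intro m' p'
      have h := hsmB p' hΦloc hΦr hΦn hVloc hVr hVn hcε x hO m'
      rw [hHs_c] at h
      calc _ ≤ ‖V L Z‖ * (CB p' / ((m' : ℝ) + 1) ^ p') := h
        _ ≤ 1 * (CB p' / ((m' : ℝ) + 1) ^ p') :=
            mul_le_mul_of_nonneg_right (hVn Z) (div_nonneg (hCB0 p') (by positivity))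
        _ = _ := one_mul _
    have hG := norm_flow_sub_twirl_quasilocal_le_pow hΨloc hs1 hΨc' hU0 hU' hU1 hU2 hJ₀1 hε0 hε hJ'
      hKg0 hK' x hFn hCB0 hcentB hsmem ℓ p
    have hG' : ‖(U s)ᴴ * F * U s - twirl S ((U s)ᴴ * F * U s)‖ ≤ TB p / ((ℓ : ℝ) + 1) ^ p := by
      refine hG.trans (le_of_eq ?_)
      rw [hTB, hE]
    have key : TB p / ((ℓ : ℝ) + 1) ^ p ≤ (C₀ + TA p + CA p + TB p) / ((ℓ : ℝ) + 1) ^ p := by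
      refine div_le_div_of_nonneg_right ?_ (hpow ℓ p).le
      have := hTA0 p; have := hCA0 p
      linarith
    rw [hstar]
    exact hG'.trans key

end Final

end Literature.MathematicalPhysics.QuantumLattice
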